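import Mathlib.LinearAlgebra.Matrix.NonsingularInverse
import Mathlib.LinearAlgebra.Matrix.ToLinearEquiv
import Mathlib.LinearAlgebra.Matrix.Trace
import Mathlib.LinearAlgebra.Matrix.DotProduct
import Mathlib.Algebra.Order.Star.Real
import Mathlib.Analysis.SpecialFunctions.Pow.Real
import HarnessLib

/-!
# Route `VirialFluxGap` (YangMills): the RESOLVENT EULER FIELD — abstract matrix layer, I (identity, drive, trace)

Toward the deciding crux `VirialFluxGap.PeriodicSoftness` (item stmt-QuantumFields-24141) through the landed reduction
✓`EulerFieldReduction.periodicSoftness_of_eulerField` («EulerField» ⇒ PeriodicSoftness).  In the GENERIC region of the toron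
valley (holonomies `ρ`-far from the centre) the Euler field can be taken to be ONE global, gauge-covariant formula in the
right-translation frame `∂_i` of the ring group,

  `X_g(x) := ½ · (H(x) + λ⋆)⁻¹ · g(x)`,   `g_i = ∂_i F₀`,  `H_ij = ½(∂_i∂_j + ∂_j∂_i) F₀`,  `λ⋆ > 0` a small spectral floor,

(the «resolvent Euler field»): it gives weight `≈ 0` to every SOFT direction of `H(x)` (gauge-orbit AND valley directions) and
weight `½` to every MASSIVE one automatically — no chart, no reference toron, no valley net, no tangent/normal projector.  This file is
the model-free LINEAR ALGEBRA behind its two pointwise estimates (part I; part II = `VirialFluxGapResolventFieldEstimates`).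
Throughout `A = H + λ⋆·1` with `Hᵀ = H` and the floor `c|v|² ≤ vᵀAv`, `c > 0` (near the valley `H ⪰ −λ⋆/2`, `c = λ⋆/2`):

* §1 letters: `A` is invertible, `c²|A⁻¹w|² ≤ |w|²`, `0 ≤ wᵀA⁻¹w ≤ |w|²/c`, Cauchy–Schwarz;
* §2 ★ `hess_resolvent_identity` — `(Hu)ᵀA⁻¹(Hu) = uᵀHu − λ⋆|u|² + λ⋆²·uᵀA⁻¹u ≥ uᵀHu − λ⋆|u|²` (NO eigen-decomposition: the
  price of the intermediate eigenvalues of `H` is exactly `λ⋆|u|²`);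
  ★★ `drive_lower` — with `g = r − Hu` (Taylor: `u` = logarithm to a nearby zero of `F₀`, `r` the remainder):
  `gᵀA⁻¹g ≥ (1−η)(uᵀHu − λ⋆|u|²) − (η⁻¹ − 1)|r|²/c`;
* §3 ★★ `trace_resolvent_le` — if `k_1 … k_m` are orthonormal with `k_aᵀ H k_a ≤ s` (approximate kernel: gauge + moduli
  directions), then `tr(A⁻¹H) ≤ (#ι − m) + m·s/(s + λ⋆)` (via `tr(A⁻¹H) = #ι − λ⋆·tr A⁻¹`, `tr A⁻¹ ≥ Σ_a k_aᵀA⁻¹k_a`,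
  `kᵀAk · kᵀA⁻¹k ≥ 1`) — the `#ι − m` massive directions count `≤ 1` each, the soft ones `≤ s/(s+λ⋆)`.

With `#ι = 18L⁴ + 3L³`, `m = 3L³ + 3`: `½tr(A⁻¹H) ≤ 9L⁴ − 3/2 + o(1)`.

HONEST FRAMING: helper linear algebra; the field itself (frame calculus on the ring group, the `3L³ + 3` kernel directions at a
regular flat ring history, the central charts and the patching) is NOT here; ⟨24141⟩ stays OPEN; no stub / crux / rung / summit is
closed; the Yang–Mills mass gap is NOT proved; no summit is proved by a line.  THEOREMS ONLY (0 `def`, 0 `sorry`), standard axioms.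
Explicit-unit seat `ym-line-fcl-p3` g40 (cell ym-idea-1, free hands), `--supports stmt-QuantumFields-24141`.
References: [folklore] (resolvent identities, Cauchy–Schwarz in a positive form, partial traces).
-/

set_option autoImplicit false

open Matrix
open scoped BigOperators

namespace Summit.QuantumFields.YangMills.Theorems.VirialFluxGap.ResolventField

variable {ι : Type*} [Fintype ι] [DecidableEq ι]

/-! ## §1 Letters on the shifted Hessian `A = H + λ⋆·1` -/

omit [DecidableEq ι] in
/-- A symmetric real matrix acts self-adjointly in the dot product: `v ⬝ (A w) = (A v) ⬝ w`. [folklore] -/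
theorem dotProduct_mulVec_symm {A : Matrix ι ι ℝ} (hA : Aᵀ = A) (v w : ι → ℝ) :
    v ⬝ᵥ (A *ᵥ w) = (A *ᵥ v) ⬝ᵥ w := by
  rw [dotProduct_mulVec, ← mulVec_transpose, hA]

omit [DecidableEq ι] in
/-- `0 ≤ Σ_i v_i·v_i` (the real dot square), from Mathlib's `dotProduct_self_star_nonneg` (trivial star on `ℝ`). [folklore] -/
theorem dpnn (v : ι → ℝ) : (0 : ℝ) ≤ ∑ i, v i * v i := by
  simpa [dotProduct] using dotProduct_self_star_nonneg v

omit [DecidableEq ι] in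
/-- Cauchy–Schwarz for finite real sums, `(Σ r_i v_i)² ≤ (Σ r_i r_i)(Σ v_i v_i)` — Mathlib's `Finset.sum_mul_sq_le_sq_mul_sq` with the
squares written as products (the dot-product normal form). [folklore] -/
theorem dpcs (r v : ι → ℝ) : (∑ i, r i * v i) ^ 2 ≤ (∑ i, r i * r i) * ∑ i, v i * v i := by
  have h := Finset.sum_mul_sq_le_sq_mul_sq Finset.univ r v
  simpa only [sq] using h

/-- A coordinate is bounded by the norm: `(v i)² ≤ v ⬝ v`. [folklore] -/
theorem sq_apply_le_dotProduct (v : ι → ℝ) (i : ι) : (v i) ^ 2 ≤ v ⬝ᵥ v := by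
  rw [dotProduct, ← Finset.sum_erase_add _ _ (Finset.mem_univ i)]
  have : 0 ≤ ∑ j ∈ Finset.univ.erase i, v j * v j := Finset.sum_nonneg fun j _ => mul_self_nonneg _
  nlinarith

omit [DecidableEq ι] in
/-- A matrix with a positive quadratic floor `c|v|² ≤ vᵀAv` (`c > 0`) has only the trivial kernel vector. [folklore] -/
theorem mulVec_eq_zero_imp {A : Matrix ι ι ℝ} {c : ℝ} (hc : 0 < c) (hfl : ∀ v, c * (v ⬝ᵥ v) ≤ v ⬝ᵥ (A *ᵥ v))
    {v : ι → ℝ} (hv : A *ᵥ v = 0) : v = 0 := by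
  have h1 := hfl v
  rw [hv, dotProduct_zero] at h1
  have h2 : v ⬝ᵥ v ≤ 0 := by
    by_contra h
    push Not at h
    have : 0 < c * (v ⬝ᵥ v) := mul_pos hc h
    linarith
  exact dotProduct_self_eq_zero.1 (le_antisymm h2 ((dpnn v)))

/-- A matrix with a positive quadratic floor has a unit determinant. [folklore] -/
theorem isUnit_det_of_floor {A : Matrix ι ι ℝ} {c : ℝ} (hc : 0 < c) (hfl : ∀ v, c * (v ⬝ᵥ v) ≤ v ⬝ᵥ (A *ᵥ v)) :
    IsUnit A.det := by
  rw [isUnit_iff_ne_zero, ne_eq, ← Matrix.exists_mulVec_eq_zero_iff]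
  rintro ⟨v, hv, h0⟩
  exact hv (mulVec_eq_zero_imp hc hfl h0)

/-- `A⁻¹` of a symmetric matrix is symmetric. [folklore] -/
theorem transpose_inv_of_symm {A : Matrix ι ι ℝ} (hA : Aᵀ = A) : A⁻¹ᵀ = A⁻¹ := by
  rw [transpose_nonsing_inv, hA]

/-- `A (A⁻¹ w) = w` under a positive floor. [folklore] -/
theorem mulVec_inv_mulVec {A : Matrix ι ι ℝ} {c : ℝ} (hc : 0 < c) (hfl : ∀ v, c * (v ⬝ᵥ v) ≤ v ⬝ᵥ (A *ᵥ v))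
    (w : ι → ℝ) : A *ᵥ (A⁻¹ *ᵥ w) = w := by
  rw [mulVec_mulVec, mul_nonsing_inv _ (isUnit_det_of_floor hc hfl), one_mulVec]

/-- `A⁻¹ (A w) = w` under a positive floor. [folklore] -/
theorem inv_mulVec_mulVec {A : Matrix ι ι ℝ} {c : ℝ} (hc : 0 < c) (hfl : ∀ v, c * (v ⬝ᵥ v) ≤ v ⬝ᵥ (A *ᵥ v))
    (w : ι → ℝ) : A⁻¹ *ᵥ (A *ᵥ w) = w := by
  rw [mulVec_mulVec, nonsing_inv_mul _ (isUnit_det_of_floor hc hfl), one_mulVec]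

/-- The resolvent form is nonnegative: `wᵀA⁻¹w = (A⁻¹w)ᵀ A (A⁻¹w) ≥ c|A⁻¹w|² ≥ 0`. [folklore] -/
theorem inv_form_nonneg {A : Matrix ι ι ℝ} {c : ℝ} (hc : 0 < c)
    (hfl : ∀ v, c * (v ⬝ᵥ v) ≤ v ⬝ᵥ (A *ᵥ v)) (w : ι → ℝ) : 0 ≤ w ⬝ᵥ (A⁻¹ *ᵥ w) := by
  have h : w ⬝ᵥ (A⁻¹ *ᵥ w) = (A⁻¹ *ᵥ w) ⬝ᵥ (A *ᵥ (A⁻¹ *ᵥ w)) := by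
    rw [mulVec_inv_mulVec hc hfl, dotProduct_comm]
  rw [h]
  exact le_trans (mul_nonneg hc.le ((dpnn _))) (hfl _)

/-- Norm control of the resolvent: `c²·|A⁻¹w|² ≤ |w|²` (i.e. `|A⁻¹w| ≤ |w|/c`). [folklore] -/
theorem inv_mulVec_sq_le {A : Matrix ι ι ℝ} {c : ℝ} (hc : 0 < c)
    (hfl : ∀ v, c * (v ⬝ᵥ v) ≤ v ⬝ᵥ (A *ᵥ v)) (w : ι → ℝ) :
    c ^ 2 * ((A⁻¹ *ᵥ w) ⬝ᵥ (A⁻¹ *ᵥ w)) ≤ w ⬝ᵥ w := by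
  set v := A⁻¹ *ᵥ w with hv
  have hAv : A *ᵥ v = w := mulVec_inv_mulVec hc hfl w
  have h1 : c * (v ⬝ᵥ v) ≤ v ⬝ᵥ w := by simpa [hAv] using hfl v
  have hvv : 0 ≤ v ⬝ᵥ v := (dpnn v)
  have hcs : (v ⬝ᵥ w) ^ 2 ≤ (v ⬝ᵥ v) * (w ⬝ᵥ w) := (dpcs v w)
  have h2 : (c * (v ⬝ᵥ v)) ^ 2 ≤ (v ⬝ᵥ w) ^ 2 := by
    have h0 : 0 ≤ c * (v ⬝ᵥ v) := mul_nonneg hc.le hvv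
    nlinarith
  -- `c²|v|⁴ ≤ |v|²|w|²`; cancel `|v|²` (or `v = 0`)
  rcases hvv.eq_or_lt with hvz | hvpos
  · rw [← hvz, mul_zero]; exact dpnn w
  · have h3 : (v ⬝ᵥ v) * (c ^ 2 * (v ⬝ᵥ v)) ≤ (v ⬝ᵥ v) * (w ⬝ᵥ w) := by nlinarith
    exact le_of_mul_le_mul_left h3 hvpos

/-- The resolvent form is bounded: `wᵀA⁻¹w ≤ |w|²/c`. [folklore] -/
theorem inv_form_le {A : Matrix ι ι ℝ} {c : ℝ} (hc : 0 < c)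
    (hfl : ∀ v, c * (v ⬝ᵥ v) ≤ v ⬝ᵥ (A *ᵥ v)) (w : ι → ℝ) : w ⬝ᵥ (A⁻¹ *ᵥ w) ≤ (w ⬝ᵥ w) / c := by
  set v := A⁻¹ *ᵥ w with hv
  have hsq := inv_mulVec_sq_le hc hfl w
  have hcs : (w ⬝ᵥ v) ^ 2 ≤ (w ⬝ᵥ w) * (v ⬝ᵥ v) := (dpcs w v)
  have hwv0 : 0 ≤ w ⬝ᵥ v := inv_form_nonneg hc hfl w
  have hww : 0 ≤ w ⬝ᵥ w := (dpnn w)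
  have hq0 : 0 ≤ (w ⬝ᵥ w) / c := div_nonneg hww hc.le
  have hvv_le : v ⬝ᵥ v ≤ (w ⬝ᵥ w) / c ^ 2 := by
    rw [le_div_iff₀ (pow_pos hc 2)]; linarith [hsq]
  have h3 : (w ⬝ᵥ v) ^ 2 ≤ ((w ⬝ᵥ w) / c) ^ 2 :=
    calc (w ⬝ᵥ v) ^ 2 ≤ (w ⬝ᵥ w) * (v ⬝ᵥ v) := hcs
      _ ≤ (w ⬝ᵥ w) * ((w ⬝ᵥ w) / c ^ 2) := mul_le_mul_of_nonneg_left hvv_le hww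
      _ = ((w ⬝ᵥ w) / c) ^ 2 := by field_simp
  nlinarith [mul_nonneg hwv0 hq0]

/-! ## §2 The resolvent identity and the driving estimate `X_g·F₀ ≥ (1−η)F₀` -/

omit [Fintype ι] in
/-- `A = H + λ⋆·1` is symmetric when `H` is. [folklore] -/
theorem transpose_shift {H : Matrix ι ι ℝ} (hH : Hᵀ = H) (lam : ℝ) :
    (H + lam • (1 : Matrix ι ι ℝ))ᵀ = H + lam • (1 : Matrix ι ι ℝ) := by
  rw [transpose_add, transpose_smul, transpose_one, hH]

/-- ★ THE RESOLVENT IDENTITY.  For `A = H + λ⋆·1` symmetric with a positive floor: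
`(Hu)ᵀA⁻¹(Hu) = uᵀHu − λ⋆|u|² + λ⋆²·uᵀA⁻¹u` — from `A⁻¹(Hu) = u − λ⋆A⁻¹u`. [folklore] -/
theorem hess_resolvent_identity {H : Matrix ι ι ℝ} (hH : Hᵀ = H) {lam c : ℝ} (hc : 0 < c)
    (hfl : ∀ v, c * (v ⬝ᵥ v) ≤ v ⬝ᵥ ((H + lam • (1 : Matrix ι ι ℝ)) *ᵥ v)) (u : ι → ℝ) :
    (H *ᵥ u) ⬝ᵥ ((H + lam • (1 : Matrix ι ι ℝ))⁻¹ *ᵥ (H *ᵥ u)) =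
      u ⬝ᵥ (H *ᵥ u) - lam * (u ⬝ᵥ u) + lam ^ 2 * (u ⬝ᵥ ((H + lam • (1 : Matrix ι ι ℝ))⁻¹ *ᵥ u)) := by
  set A := H + lam • (1 : Matrix ι ι ℝ) with hAdef
  have hA : Aᵀ = A := transpose_shift hH lam
  have hHu : H *ᵥ u = A *ᵥ u - lam • u := by
    rw [hAdef, add_mulVec, smul_mulVec, one_mulVec]; abel
  have hinv : A⁻¹ *ᵥ (H *ᵥ u) = u - lam • (A⁻¹ *ᵥ u) := by
    rw [hHu, mulVec_sub, inv_mulVec_mulVec hc hfl, mulVec_smul]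
  have h1 : (A *ᵥ u) ⬝ᵥ (A⁻¹ *ᵥ u) = u ⬝ᵥ u := by
    rw [← dotProduct_mulVec_symm hA, mulVec_inv_mulVec hc hfl]
  have h2 : u ⬝ᵥ (A *ᵥ u) = u ⬝ᵥ (H *ᵥ u) + lam * (u ⬝ᵥ u) := by
    rw [hAdef, add_mulVec, smul_mulVec, one_mulVec, dotProduct_add, dotProduct_smul, smul_eq_mul]
  have h3 : (A *ᵥ u) ⬝ᵥ u = u ⬝ᵥ (A *ᵥ u) := by rw [dotProduct_mulVec_symm hA]
  rw [hinv, dotProduct_sub, dotProduct_smul, hHu, sub_dotProduct, sub_dotProduct, smul_dotProduct, smul_dotProduct, h1, h3,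
    h2, dotProduct_sub, dotProduct_smul, h2]
  simp only [smul_eq_mul]
  ring

/-- ★ Corollary: `(Hu)ᵀA⁻¹(Hu) ≥ uᵀHu − λ⋆|u|²` — the massive directions are reproduced with relative loss `λ⋆/μ`, the soft ones cost
at most `λ⋆|u|²`, with NO spectral decomposition. [folklore] -/
theorem hess_resolvent_ge {H : Matrix ι ι ℝ} (hH : Hᵀ = H) {lam c : ℝ} (hc : 0 < c)
    (hfl : ∀ v, c * (v ⬝ᵥ v) ≤ v ⬝ᵥ ((H + lam • (1 : Matrix ι ι ℝ)) *ᵥ v)) (u : ι → ℝ) :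
    u ⬝ᵥ (H *ᵥ u) - lam * (u ⬝ᵥ u) ≤ (H *ᵥ u) ⬝ᵥ ((H + lam • (1 : Matrix ι ι ℝ))⁻¹ *ᵥ (H *ᵥ u)) := by
  rw [hess_resolvent_identity hH hc hfl u]
  nlinarith [inv_form_nonneg hc hfl u, sq_nonneg lam]

omit [DecidableEq ι] in
/-- Polarisation letter for a nonnegative symmetric form `Q(v) = vᵀBv`: `2|xᵀBy| ≤ η·xᵀBx + η⁻¹·yᵀBy` (`η > 0`), from
`0 ≤ Q(x ∓ η⁻¹y)`; used with `B = A⁻¹`. [folklore] -/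
theorem two_mul_abs_form_le {B : Matrix ι ι ℝ} (hB : Bᵀ = B) (hpos : ∀ v, 0 ≤ v ⬝ᵥ (B *ᵥ v)) {η : ℝ} (hη : 0 < η)
    (x y : ι → ℝ) : 2 * |x ⬝ᵥ (B *ᵥ y)| ≤ η * (x ⬝ᵥ (B *ᵥ x)) + η⁻¹ * (y ⬝ᵥ (B *ᵥ y)) := by
  have hxy : y ⬝ᵥ (B *ᵥ x) = x ⬝ᵥ (B *ᵥ y) := by rw [dotProduct_mulVec_symm hB, dotProduct_comm]
  have key : ∀ σ : ℝ, σ ^ 2 = 1 → 2 * σ * (x ⬝ᵥ (B *ᵥ y)) ≤ η * (x ⬝ᵥ (B *ᵥ x)) + η⁻¹ * (y ⬝ᵥ (B *ᵥ y)) := by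
    intro σ hσ
    have h := hpos (x - (σ * η⁻¹) • y)
    have hexp : (x - (σ * η⁻¹) • y) ⬝ᵥ (B *ᵥ (x - (σ * η⁻¹) • y)) =
        x ⬝ᵥ (B *ᵥ x) - 2 * (σ * η⁻¹) * (x ⬝ᵥ (B *ᵥ y)) + (σ * η⁻¹) ^ 2 * (y ⬝ᵥ (B *ᵥ y)) := by
      simp only [mulVec_sub, mulVec_smul, sub_dotProduct, dotProduct_sub, smul_dotProduct, dotProduct_smul, smul_eq_mul,
        hxy]
      ring
    rw [hexp] at h
    have hη' : η * η⁻¹ = 1 := mul_inv_cancel₀ hη.ne'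
    have h2 := mul_nonneg hη.le h
    have hcalc : η * (x ⬝ᵥ (B *ᵥ x) - 2 * (σ * η⁻¹) * (x ⬝ᵥ (B *ᵥ y)) + (σ * η⁻¹) ^ 2 * (y ⬝ᵥ (B *ᵥ y))) =
        η * (x ⬝ᵥ (B *ᵥ x)) - 2 * σ * (η * η⁻¹) * (x ⬝ᵥ (B *ᵥ y)) + σ ^ 2 * (η * η⁻¹) * η⁻¹ * (y ⬝ᵥ (B *ᵥ y)) := by
      ring
    rw [hcalc, hη', hσ] at h2
    linarith
  have h1 := key 1 (by norm_num)
  have h2 := key (-1) (by norm_num)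
  have habs : |x ⬝ᵥ (B *ᵥ y)| ≤ (η * (x ⬝ᵥ (B *ᵥ x)) + η⁻¹ * (y ⬝ᵥ (B *ᵥ y))) / 2 := by
    rw [abs_le]; constructor <;> linarith
  linarith

/-- ★★ THE DRIVING ESTIMATE.  For `A = H + λ⋆·1` symmetric with floor `c|v|² ≤ vᵀAv` (`c > 0`), `g = r − Hu` and `0 < η < 1`:
`gᵀA⁻¹g ≥ (1−η)·(uᵀHu − λ⋆|u|²) − (η⁻¹ − 1)·|r|²/c`.  (In the field construction `u` is the logarithm from `x` to a nearby zero of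
`F₀`, `r` the second-order Taylor remainder of `∇F₀`, `c = λ⋆/2`.) [folklore] -/
theorem drive_lower {H : Matrix ι ι ℝ} (hH : Hᵀ = H) {lam c η : ℝ} (hc : 0 < c) (hη : 0 < η) (hη1 : η < 1)
    (hfl : ∀ v, c * (v ⬝ᵥ v) ≤ v ⬝ᵥ ((H + lam • (1 : Matrix ι ι ℝ)) *ᵥ v)) {u r g : ι → ℝ} (hg : g = r - H *ᵥ u) :
    (1 - η) * (u ⬝ᵥ (H *ᵥ u) - lam * (u ⬝ᵥ u)) - (η⁻¹ - 1) * ((r ⬝ᵥ r) / c) ≤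
      g ⬝ᵥ ((H + lam • (1 : Matrix ι ι ℝ))⁻¹ *ᵥ g) := by
  set A := H + lam • (1 : Matrix ι ι ℝ) with hAdef
  have hA : Aᵀ = A := transpose_shift hH lam
  have hB : A⁻¹ᵀ = A⁻¹ := transpose_inv_of_symm hA
  have hBpos : ∀ v, 0 ≤ v ⬝ᵥ (A⁻¹ *ᵥ v) := inv_form_nonneg hc hfl
  have hsym : (H *ᵥ u) ⬝ᵥ (A⁻¹ *ᵥ r) = r ⬝ᵥ (A⁻¹ *ᵥ (H *ᵥ u)) := by
    rw [dotProduct_mulVec_symm hB, dotProduct_comm]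
  have hexp : g ⬝ᵥ (A⁻¹ *ᵥ g) = (H *ᵥ u) ⬝ᵥ (A⁻¹ *ᵥ (H *ᵥ u)) - 2 * (r ⬝ᵥ (A⁻¹ *ᵥ (H *ᵥ u))) + r ⬝ᵥ (A⁻¹ *ᵥ r) := by
    rw [hg]
    simp only [mulVec_sub, sub_dotProduct, dotProduct_sub, hsym]
    ring
  have hmain := hess_resolvent_ge hH hc hfl u
  have hcross := two_mul_abs_form_le hB hBpos hη (H *ᵥ u) r
  rw [hsym] at hcross
  have hrr : r ⬝ᵥ (A⁻¹ *ᵥ r) ≤ (r ⬝ᵥ r) / c := inv_form_le hc hfl r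
  have habs : r ⬝ᵥ (A⁻¹ *ᵥ (H *ᵥ u)) ≤ |r ⬝ᵥ (A⁻¹ *ᵥ (H *ᵥ u))| := le_abs_self _
  have hη2 : 0 ≤ η⁻¹ - 1 := by
    rw [sub_nonneg]; exact (one_le_inv₀ hη).2 hη1.le
  have F1 := mul_le_mul_of_nonneg_left hmain (by linarith : (0:ℝ) ≤ 1 - η)
  have F2 := mul_le_mul_of_nonneg_left hrr hη2
  rw [hexp]
  linarith

/-! ## §3 The trace estimate `tr(A⁻¹H) ≤ (#ι − m) + m·s/(s+λ⋆)` from an approximate kernel -/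

/-- `tr(A⁻¹H) = #ι − λ⋆·tr(A⁻¹)` for `A = H + λ⋆·1` with a positive floor. [folklore] -/
theorem trace_inv_mul_hess {H : Matrix ι ι ℝ} {lam c : ℝ} (hc : 0 < c)
    (hfl : ∀ v, c * (v ⬝ᵥ v) ≤ v ⬝ᵥ ((H + lam • (1 : Matrix ι ι ℝ)) *ᵥ v)) :
    Matrix.trace ((H + lam • (1 : Matrix ι ι ℝ))⁻¹ * H) =
      (Fintype.card ι : ℝ) - lam * Matrix.trace (H + lam • (1 : Matrix ι ι ℝ))⁻¹ := by
  set A := H + lam • (1 : Matrix ι ι ℝ) with hAdef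
  have hH : H = A - lam • (1 : Matrix ι ι ℝ) := by rw [hAdef]; abel
  have hunit := isUnit_det_of_floor hc hfl
  rw [hH, Matrix.mul_sub, nonsing_inv_mul _ hunit, Matrix.mul_smul, Matrix.mul_one, trace_sub, trace_one, trace_smul,
    smul_eq_mul]

/-- For a unit vector `k` and `A` symmetric with a positive floor: `1 ≤ (kᵀAk)·(kᵀA⁻¹k)` — Cauchy–Schwarz in the `A`-form, proved
as `0 ≤ (k − t A⁻¹k)ᵀA(k − t A⁻¹k)` at `t = kᵀAk`. [folklore] -/
theorem one_le_form_mul_inv_form {A : Matrix ι ι ℝ} {c : ℝ} (hA : Aᵀ = A) (hc : 0 < c)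
    (hfl : ∀ v, c * (v ⬝ᵥ v) ≤ v ⬝ᵥ (A *ᵥ v)) {k : ι → ℝ} (hk : k ⬝ᵥ k = 1) :
    1 ≤ (k ⬝ᵥ (A *ᵥ k)) * (k ⬝ᵥ (A⁻¹ *ᵥ k)) := by
  set t := k ⬝ᵥ (A *ᵥ k) with ht
  set w := A⁻¹ *ᵥ k with hw
  have hAw : A *ᵥ w = k := mulVec_inv_mulVec hc hfl k
  have ht0 : 0 < t := by
    have := hfl k; rw [hk, mul_one] at this; exact lt_of_lt_of_le hc this
  -- `0 ≤ (k − t w)ᵀ A (k − t w) = t − 2 t (k⬝k) + t² (w ⬝ A w)`… with `A w = k`, `w⬝k = k⬝A⁻¹k`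
  have hpos : 0 ≤ (k - t • w) ⬝ᵥ (A *ᵥ (k - t • w)) :=
    le_trans (mul_nonneg hc.le ((dpnn _))) (hfl _)
  have hwk : w ⬝ᵥ k = k ⬝ᵥ (A⁻¹ *ᵥ k) := by rw [hw, dotProduct_comm]
  have hkAw : k ⬝ᵥ (A *ᵥ w) = k ⬝ᵥ k := by rw [hAw]
  have hexp : (k - t • w) ⬝ᵥ (A *ᵥ (k - t • w)) = t - 2 * t * (k ⬝ᵥ k) + t ^ 2 * (k ⬝ᵥ (A⁻¹ *ᵥ k)) := by
    have h1 : w ⬝ᵥ (A *ᵥ k) = k ⬝ᵥ (A *ᵥ w) := by rw [dotProduct_mulVec_symm hA, dotProduct_comm]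
    simp only [mulVec_sub, mulVec_smul, sub_dotProduct, dotProduct_sub, smul_dotProduct, dotProduct_smul, smul_eq_mul, hAw,
      h1, hwk, ← ht]
    ring
  rw [hexp, hk] at hpos
  -- `0 ≤ t − 2t + t²·q = t (t q − 1)` with `t > 0`
  have : 0 ≤ t * (t * (k ⬝ᵥ (A⁻¹ *ᵥ k)) - 1) := by nlinarith
  have h2 := (mul_nonneg_iff_of_pos_left ht0).1 this
  linarith

/-- Partial traces of a nonnegative symmetric form are bounded by the trace: for an orthonormal family `k_a` (`a : Fin m`) and `B`
with `vᵀBv ≥ 0`, `Σ_a k_aᵀ B k_a ≤ tr B` (the defect is `tr((1−P)B(1−P)) ≥ 0`, `P = Σ_a k_a k_aᵀ`). [folklore] -/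
theorem sum_form_le_trace {B : Matrix ι ι ℝ} (hpos : ∀ v, 0 ≤ v ⬝ᵥ (B *ᵥ v)) {m : ℕ}
    (k : Fin m → ι → ℝ) (hon : ∀ a b, k a ⬝ᵥ k b = if a = b then 1 else 0) :
    ∑ a, k a ⬝ᵥ (B *ᵥ k a) ≤ Matrix.trace B := by
  classical
  -- `K : Matrix (Fin m) ι ℝ` with rows `k a`; `K Kᵀ = 1`; `P = Kᵀ K`
  let K : Matrix (Fin m) ι ℝ := Matrix.of fun a i => k a i
  have hKK : K * Kᵀ = 1 := by
    ext a b
    simp only [Matrix.mul_apply, Matrix.transpose_apply, Matrix.of_apply, Matrix.one_apply, K]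
    have := hon a b
    simpa [dotProduct] using this
  let P : Matrix ι ι ℝ := Kᵀ * K
  have hPt : Pᵀ = P := by simp [P, Matrix.transpose_mul]
  have hPP : P * P = P := by
    simp only [P]
    rw [Matrix.mul_assoc, ← Matrix.mul_assoc K, hKK, Matrix.one_mul]
  -- `Σ_a k_a B k_a = tr(K B Kᵀ) = tr(B P)`
  have hsum : ∑ a, k a ⬝ᵥ (B *ᵥ k a) = Matrix.trace (K * (B * Kᵀ)) := by
    simp only [Matrix.trace, Matrix.diag, Matrix.mul_apply, Matrix.transpose_apply, Matrix.of_apply, K, dotProduct, mulVec]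
  have htrBP : Matrix.trace (K * (B * Kᵀ)) = Matrix.trace (B * P) := by
    rw [Matrix.trace_mul_comm, Matrix.mul_assoc]
  -- defect: `tr B − tr(BP) = tr(BQ) = tr(BQQ) = tr(QBQ) ≥ 0`, `Q = 1 − P`
  set Q : Matrix ι ι ℝ := 1 - P with hQ
  have hQt : Qᵀ = Q := by rw [hQ, transpose_sub, transpose_one, hPt]
  have hQQ : Q * Q = Q := by
    rw [hQ, Matrix.sub_mul, Matrix.one_mul, Matrix.mul_sub, Matrix.mul_one, hPP, sub_self, sub_zero]
  have e1 : Matrix.trace B - Matrix.trace (B * P) = Matrix.trace (B * Q) := by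
    rw [hQ, Matrix.mul_sub, Matrix.mul_one, trace_sub]
  have e2 : Matrix.trace (B * Q) = Matrix.trace (Qᵀ * (B * Q)) := by
    rw [hQt]
    conv_lhs => rw [← hQQ, ← Matrix.mul_assoc]
    rw [Matrix.trace_mul_comm]
  have hnonneg : 0 ≤ Matrix.trace (Qᵀ * (B * Q)) := by
    have hcols : Matrix.trace (Qᵀ * (B * Q)) = ∑ i, (fun j => Q j i) ⬝ᵥ (B *ᵥ fun j => Q j i) := by
      simp only [Matrix.trace, Matrix.diag, Matrix.mul_apply, Matrix.transpose_apply, dotProduct, mulVec]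
    rw [hcols]
    exact Finset.sum_nonneg fun i _ => hpos _
  linarith [hsum, htrBP, e1, e2, hnonneg]

/-- ★★ THE TRACE ESTIMATE.  For `A = H + λ⋆·1` symmetric with a positive floor, and an orthonormal family `k_a` (`a : Fin m`) of
APPROXIMATE KERNEL vectors, `k_aᵀ H k_a ≤ s` with `0 ≤ s`:  `tr(A⁻¹H) ≤ (#ι − m) + m·s/(s + λ⋆)`.
(In the field construction: `m = 3L³ + 3` = gauge-orbit + moduli directions at a nearby flat ring history, `s = M₃·d`; the `#ι − m =
18L⁴ − 3` massive directions contribute `≤ 1` each, the soft ones `≤ s/(s+λ⋆)` each.)  Requires `0 < λ⋆`. [folklore] -/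
theorem trace_resolvent_le {H : Matrix ι ι ℝ} (hH : Hᵀ = H) {lam c s : ℝ} (hlam : 0 < lam) (hc : 0 < c) (hs : 0 ≤ s)
    (hfl : ∀ v, c * (v ⬝ᵥ v) ≤ v ⬝ᵥ ((H + lam • (1 : Matrix ι ι ℝ)) *ᵥ v)) {m : ℕ} (k : Fin m → ι → ℝ)
    (hon : ∀ a b, k a ⬝ᵥ k b = if a = b then 1 else 0) (hker : ∀ a, k a ⬝ᵥ (H *ᵥ k a) ≤ s) :
    Matrix.trace ((H + lam • (1 : Matrix ι ι ℝ))⁻¹ * H) ≤ (Fintype.card ι : ℝ) - m + m * (s / (s + lam)) := by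
  set A := H + lam • (1 : Matrix ι ι ℝ) with hAdef
  have hA : Aᵀ = A := transpose_shift hH lam
  have hB : A⁻¹ᵀ = A⁻¹ := transpose_inv_of_symm hA
  have hBpos : ∀ v, 0 ≤ v ⬝ᵥ (A⁻¹ *ᵥ v) := inv_form_nonneg hc hfl
  rw [trace_inv_mul_hess hc hfl]
  -- `tr A⁻¹ ≥ Σ_a k_a A⁻¹ k_a ≥ m / (s + λ⋆)`
  have hpart := sum_form_le_trace hBpos k hon
  have heach : ∀ a, 1 / (s + lam) ≤ k a ⬝ᵥ (A⁻¹ *ᵥ k a) := by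
    intro a
    have hk1 : k a ⬝ᵥ k a = 1 := by simpa using hon a a
    have h1 := one_le_form_mul_inv_form hA hc hfl hk1
    have hkA : k a ⬝ᵥ (A *ᵥ k a) = k a ⬝ᵥ (H *ᵥ k a) + lam := by
      rw [hAdef, add_mulVec, smul_mulVec, one_mulVec, dotProduct_add, dotProduct_smul, smul_eq_mul, hk1, mul_one]
    have hkA_le : k a ⬝ᵥ (A *ᵥ k a) ≤ s + lam := by rw [hkA]; linarith [hker a]
    have hkA_pos : 0 < k a ⬝ᵥ (A *ᵥ k a) := by
      have := hfl (k a); rw [hk1, mul_one] at this; linarith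
    rw [div_le_iff₀ (by linarith : 0 < s + lam)]
    calc 1 ≤ (k a ⬝ᵥ (A *ᵥ k a)) * (k a ⬝ᵥ (A⁻¹ *ᵥ k a)) := h1
      _ ≤ (s + lam) * (k a ⬝ᵥ (A⁻¹ *ᵥ k a)) := mul_le_mul_of_nonneg_right hkA_le (hBpos _)
      _ = (k a ⬝ᵥ (A⁻¹ *ᵥ k a)) * (s + lam) := mul_comm _ _
  have hsum : (m : ℝ) * (1 / (s + lam)) ≤ ∑ a, k a ⬝ᵥ (A⁻¹ *ᵥ k a) := by
    calc (m : ℝ) * (1 / (s + lam)) = ∑ _a : Fin m, 1 / (s + lam) := by simp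
      _ ≤ ∑ a, k a ⬝ᵥ (A⁻¹ *ᵥ k a) := Finset.sum_le_sum fun a _ => heach a
  have htr : (m : ℝ) * (1 / (s + lam)) ≤ Matrix.trace A⁻¹ := hsum.trans hpart
  -- `#ι − λ⋆ tr A⁻¹ ≤ #ι − λ⋆ m/(s+λ⋆) = #ι − m + m s/(s+λ⋆)`
  have hkey : lam * ((m : ℝ) * (1 / (s + lam))) = m - m * (s / (s + lam)) := by
    field_simp
    ring
  nlinarith [mul_le_mul_of_nonneg_left htr hlam.le]

end Summit.QuantumFields.YangMills.Theorems.VirialFluxGap.ResolventField
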